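import Summits.QuantumFields.YangMills.Theorems.UnitScaleGibbsTemporalGaugePrimitive
import Summits.QuantumFields.YangMills.Theorems.UnitScaleGibbsNormalEquationNetFlux
import HarnessLib

/-!
# `UnitScaleGibbsTemporalGaugePrimitiveTorus` — PUSHING A BOX-SUPPORTED `ℤ^d` TEST FIELD THROUGH `castSite`: the `slotBond` curl, the support row
# of `stub_linTest`, and the torus edition of the temporal-gauge primitive (T-PRIM file 2; the (Z) → (T) dictionary)

Cell `ym3-torus` (YM ladder rung R3 = continuum SU(2) Yang–Mills on every three-torus — a RUNG, NOT d = 4, NOT infinite volume, NOT a mass gap, NOT the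
Clay problem), crux of record `UnitScaleTilt.HistoryTailL` (stmt-QuantumFields-19936); LINE 28 «GrossTransfer» registered on stmt-QuantumFields-23083; width
seat `ym-ust-19936-w5` gen 16 (★w2-19936 g15 20:07:59Z: «the `castSite` push … as your FILE 2 — your call»).  ✓`UnitScaleGibbsTemporalGaugePrimitive` built,
on `ℤ^d`, the margin-1 temporal-gauge primitive `a` of a closed margin-supported 2-form `r` with zero `0`-column sums.  The skeleton's test fields live on the
TORUS `T^{(0)}` (`u : PBond (F.P K) 0 → M₂(ℂ)`, support row `u b ≠ 0 → ∃ x, lo + 1 ≤ x ∧ x + e b.dir + 1 ≤ hi ∧ b.src = castSite x ∧ lowPart b.dir (x − lo) ≠ 0`,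
curl rows in the `slotBond` letters).  THIS FILE is the dictionary (def-free; the pushed field is spelled by classical choice on the non-wrapping box, exactly
as the linear potential of ✓`…NormalEquationNetFlux` §2):

* a PUSH of a bond field `a : Zd d → Fin d → ℝ` is any `A : PBond P j → ℝ` with `A ⟨castSite x, μ⟩ = a x μ` on box bonds (`lo ≤ x`, `x + e_μ ≤ hi`) and `A b = 0`
  off the box bonds — `exists_push` (classical choice; single-valued by ✓`castSite_injOn_box`); every lemma below takes these two rows as hypotheses;
* ★ `curl_push_of_box`: on a box plaquette `⟨castSite z, μ, ν⟩` the `slotBond` curl of the pushed field IS the `ℤ^d` letter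
  `(a(z+e_μ,ν) − a(z,ν)) − (a(z+e_ν,μ) − a(z,μ))` (✓`castSite_add_e`, four slots);
* ★ `push_support_of_margin`: the `ℤ^d` margin-1 row `a x μ ≠ 0 → μ ≠ 0 ∧ lo + 1 ≤ x ∧ x + e_μ + 1 ≤ hi ∧ lo₀ + 2 ≤ x₀` (T-PRIM's `tprim_support`) becomes the
  skeleton's support row VERBATIM, off-tree clause included (`lowPart μ (x − lo)` has the nonzero coordinate `0 < μ`);
* ★ `curl_push_eq_zero_of_not_mem` (via ✓`curl_support_of_margin`): off the box plaquettes the pushed field has zero curl;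
* ★★★ `exists_torus_temporalGauge_primitive`: for `r` on `ℤ^d` antisymmetric, closed, margin-1-supported in a NON-WRAPPING box with zero `0`-column sums,
  there is `u : PBond P j → ℝ` with the skeleton's support row and whose `slotBond` curl is `r` (read at the integer base point) on `boxPlaqs lo hi` and `0`
  elsewhere; with the column bound `|u ⟨castSite x, μ⟩| ≤ Σ_k |r(x[0↦lo₀+k],0,μ)|`.

HONEST SCOPE.  Bookkeeping (classical choice + injectivity of `castSite` on a non-wrapping box + four-slot case analysis); proves no stub, closes no item.
Nothing of `stub_linTest`, «ShallowFluxSecondMomentL», (Q), 23083/23133/23134, K1 or `HistoryTailL` is proved.  YM₃ on T³ is rung R3 — NOT d = 4, NOT a mass gap,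
NOT Clay.  References: T. Bałaban, CMP **95** (1984) 17–40 [Balaban1984PropagatorsI] ((1.10) p.19); CMP **98** (1985) 17–51 [Balaban1985Averaging] ((5) p.18).
-/

set_option autoImplicit false

noncomputable section

open scoped BigOperators
open Literature.MathematicalPhysics.QuantumFieldTheory.Balaban1983to89
open Literature.MathematicalPhysics.QuantumFieldTheory.Balaban1983to89.B4Eq19LatticeOperators (Zd unitVec)
open Literature.MathematicalPhysics.QuantumFieldTheory.Balaban1983to89.T4AxialGaugeSmallField (castSite castSite_add_e
  castSite_injOn_box boxPlaqs)
open Literature.MathematicalPhysics.QuantumFieldTheory.Balaban1983to89.B7Prop1Explicit (e)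
open Literature.MathematicalPhysics.QuantumFieldTheory.Balaban1983to89.B8Lemma1NonAbelian (lowPart lowPart_apply e_nonneg)
open Summit.QuantumFields.YangMills.Theorems.UnitScaleGibbsActionDerivativeSlotCalculus (slotBond)
open Summit.QuantumFields.YangMills.Theorems.UnitScaleGibbsNormalEquationNetFlux (curl_slotBond_eq curl_support_of_margin)
open Summit.QuantumFields.YangMills.Theorems.UnitScaleGibbsTemporalGaugePrimitive (exists_temporalGauge_primitive)

namespace Summit.QuantumFields.YangMills.Theorems.UnitScaleGibbsTemporalGaugePrimitiveTorus

variable {P : Params} {j : ℕ}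

/-- The two unit-vector letters agree: `B7Prop1Explicit.e μ = B4Eq19LatticeOperators.unitVec μ` (both `Pi.single μ 1`). [folklore] -/
theorem e_eq_unitVec (μ : Fin P.d) : (e μ : Fin P.d → ℤ) = unitVec μ := rfl

/-- `y + e_κ ≤ hi → y ≤ hi`. [folklore] -/
theorem le_of_add_e_le {y hi : Fin P.d → ℤ} (κ : Fin P.d) (h : y + e κ ≤ hi) : y ≤ hi :=
  le_trans (le_add_of_nonneg_right (e_nonneg κ)) h

/-! ## §1 Pushing a box field through `castSite` -/

/-- **A PUSH EXISTS**: on a non-wrapping box every `ℤ^d` bond field `a` has a torus representative `A` reading `a x μ` at the box bonds `⟨castSite x, μ⟩`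
(`lo ≤ x`, `x + e_μ ≤ hi`) and `0` off the box bonds (classical choice of the integer representative, single-valued by ✓`castSite_injOn_box`). [folklore] -/
theorem exists_push {lo hi : Fin P.d → ℤ} (hN : ∀ κ, hi κ - lo κ < P.sitesPerDir j) (a : Zd P.d → Fin P.d → ℝ) :
    ∃ A : PBond P j → ℝ,
      (∀ (x : Fin P.d → ℤ) (μ : Fin P.d), lo ≤ x → x + e μ ≤ hi → A ⟨castSite x, μ⟩ = a x μ) ∧
      (∀ b : PBond P j, (¬ ∃ y : Fin P.d → ℤ, lo ≤ y ∧ y + e b.dir ≤ hi ∧ b.src = castSite y) → A b = 0) := by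
  classical
  refine ⟨fun b => if h : ∃ y : Fin P.d → ℤ, lo ≤ y ∧ y + e b.dir ≤ hi ∧ b.src = castSite y
      then a (Classical.choose h) b.dir else 0, ?_, ?_⟩
  · intro x μ hx hxμ
    have h : ∃ y : Fin P.d → ℤ, lo ≤ y ∧ y + e μ ≤ hi ∧ (castSite x : Site P j) = castSite y := ⟨x, hx, hxμ, rfl⟩
    simp only [dif_pos h]
    obtain ⟨h1, h2, h3⟩ := Classical.choose_spec h
    rw [← castSite_injOn_box hN hx (le_of_add_e_le μ hxμ) h1 (le_of_add_e_le μ h2) h3]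
  · intro b hb
    simp only [dif_neg hb]

/-! ## §2 The `slotBond` curl of a pushed field on box plaquettes -/

/-- ★ **THE CURL DICTIONARY**: for a box plaquette `p = ⟨castSite z, μ, ν⟩` (`lo ≤ z`, `z + e_μ + e_ν ≤ hi`), the `slotBond` curl of a pushed field is the
`ℤ^d` letter `(a(z+e_μ,ν) − a(z,ν)) − (a(z+e_ν,μ) − a(z,μ))` of ✓`CovariantDischargeLatticeFormsDeg23`. [cite: Balaban1985Averaging, (5) p.18] -/
theorem curl_push_of_box {lo hi : Fin P.d → ℤ} (a : Zd P.d → Fin P.d → ℝ) (A : PBond P j → ℝ)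
    (hA : ∀ (x : Fin P.d → ℤ) (μ : Fin P.d), lo ≤ x → x + e μ ≤ hi → A ⟨castSite x, μ⟩ = a x μ)
    {z : Fin P.d → ℤ} {μ ν : Fin P.d} (hμν : μ < ν) (hz : lo ≤ z) (hzhi : z + e μ + e ν ≤ hi) :
    A (slotBond (⟨castSite z, μ, ν, hμν⟩ : Plaq P j) 0) + A (slotBond (⟨castSite z, μ, ν, hμν⟩ : Plaq P j) 1) -
        A (slotBond (⟨castSite z, μ, ν, hμν⟩ : Plaq P j) 2) - A (slotBond (⟨castSite z, μ, ν, hμν⟩ : Plaq P j) 3) =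
      (a (z + unitVec μ) ν - a z ν) - (a (z + unitVec ν) μ - a z μ) := by
  rw [curl_slotBond_eq]
  simp only
  rw [← castSite_add_e, ← castSite_add_e]
  have hz1 : lo ≤ z + e μ := le_trans hz (le_add_of_nonneg_right (e_nonneg μ))
  have hz2 : lo ≤ z + e ν := le_trans hz (le_add_of_nonneg_right (e_nonneg ν))
  have hzμ : z + e μ ≤ hi := le_of_add_e_le ν hzhi
  have hzνμ : z + e ν + e μ ≤ hi := by rw [add_right_comm]; exact hzhi
  have hzν : z + e ν ≤ hi := le_of_add_e_le μ hzνμ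
  rw [hA z μ hz hzμ, hA (z + e μ) ν hz1 hzhi, hA (z + e ν) μ hz2 hzνμ, hA z ν hz hzν, e_eq_unitVec, e_eq_unitVec]
  ring

/-! ## §3 The support row and the vanishing of the curl off the box -/

/-- ★ **SUPPORT ROW TRANSFER**: if `a x μ ≠ 0 → μ ≠ 0 ∧ lo + 1 ≤ x ∧ x + e_μ + 1 ≤ hi ∧ lo₀ + 2 ≤ x₀` on `ℤ^d` (T-PRIM's `tprim_support`), then a pushed
field satisfies the support row of `stub_linTest` VERBATIM — margin 1 and OFF-TREE (`lowPart b.dir (x − lo)` has the coordinate `0 < b.dir` equal to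
`x₀ − lo₀ ≥ 2`). [cite: Balaban1984PropagatorsI, (1.10) p.19] -/
theorem push_support_of_margin {lo hi : Fin P.d → ℤ} (hd : 0 < P.d) (a : Zd P.d → Fin P.d → ℝ)
    (ha : ∀ x μ, a x μ ≠ 0 → μ ≠ ⟨0, hd⟩ ∧ lo + 1 ≤ x ∧ x + unitVec μ + 1 ≤ hi ∧ lo ⟨0, hd⟩ + 2 ≤ x ⟨0, hd⟩)
    (A : PBond P j → ℝ)
    (hA : ∀ (x : Fin P.d → ℤ) (μ : Fin P.d), lo ≤ x → x + e μ ≤ hi → A ⟨castSite x, μ⟩ = a x μ)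
    (hA0 : ∀ b : PBond P j, (¬ ∃ y : Fin P.d → ℤ, lo ≤ y ∧ y + e b.dir ≤ hi ∧ b.src = castSite y) → A b = 0)
    (b : PBond P j) (hb : A b ≠ 0) :
    ∃ x : Fin P.d → ℤ, lo + 1 ≤ x ∧ x + e b.dir + 1 ≤ hi ∧ b.src = castSite x ∧ lowPart b.dir (x - lo) ≠ 0 := by
  by_cases h : ∃ y : Fin P.d → ℤ, lo ≤ y ∧ y + e b.dir ≤ hi ∧ b.src = castSite y
  · obtain ⟨y, hy, hyb, hsrc⟩ := h
    have hbeq : b = ⟨castSite y, b.dir⟩ := by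
      cases b
      simp only at hsrc
      rw [hsrc]
    have hval : A b = a y b.dir := by
      conv_lhs => rw [hbeq]
      exact hA y b.dir hy hyb
    rw [hval] at hb
    obtain ⟨hdir, h1, h2, h3⟩ := ha _ _ hb
    refine ⟨y, h1, ?_, hsrc, ?_⟩
    · rw [e_eq_unitVec]; exact h2
    · intro hlow
      have h0 := congr_fun hlow ⟨0, hd⟩
      have hlt : (⟨0, hd⟩ : Fin P.d) < b.dir := by
        rcases lt_or_eq_of_le (show (⟨0, hd⟩ : Fin P.d) ≤ b.dir from Fin.mk_le_of_le_val (Nat.zero_le _)) with hlt | heq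
        · exact hlt
        · exact absurd heq.symm hdir
      rw [lowPart_apply, if_pos hlt, Pi.sub_apply, Pi.zero_apply] at h0
      omega
  · exact absurd (hA0 b h) hb

/-- The margin-1 row of the pushed field, WITHOUT the off-tree clause (the shape ✓`curl_support_of_margin` consumes). [folklore] -/
theorem push_support_margin {lo hi : Fin P.d → ℤ} (hd : 0 < P.d) (a : Zd P.d → Fin P.d → ℝ)
    (ha : ∀ x μ, a x μ ≠ 0 → μ ≠ ⟨0, hd⟩ ∧ lo + 1 ≤ x ∧ x + unitVec μ + 1 ≤ hi ∧ lo ⟨0, hd⟩ + 2 ≤ x ⟨0, hd⟩)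
    (A : PBond P j → ℝ)
    (hA : ∀ (x : Fin P.d → ℤ) (μ : Fin P.d), lo ≤ x → x + e μ ≤ hi → A ⟨castSite x, μ⟩ = a x μ)
    (hA0 : ∀ b : PBond P j, (¬ ∃ y : Fin P.d → ℤ, lo ≤ y ∧ y + e b.dir ≤ hi ∧ b.src = castSite y) → A b = 0)
    (b : PBond P j) (hb : A b ≠ 0) :
    ∃ x : Fin P.d → ℤ, lo + 1 ≤ x ∧ x + e b.dir + 1 ≤ hi ∧ b.src = castSite x := by
  obtain ⟨x, h1, h2, h3, -⟩ := push_support_of_margin hd a ha A hA hA0 b hb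
  exact ⟨x, h1, h2, h3⟩

/-- ★ **OFF THE BOX PLAQUETTES THE CURL OF A PUSHED MARGIN-1 FIELD VANISHES** (contrapositive of ✓`curl_support_of_margin`). [folklore] -/
theorem curl_push_eq_zero_of_not_mem {lo hi : Fin P.d → ℤ} (hd : 0 < P.d) (a : Zd P.d → Fin P.d → ℝ)
    (ha : ∀ x μ, a x μ ≠ 0 → μ ≠ ⟨0, hd⟩ ∧ lo + 1 ≤ x ∧ x + unitVec μ + 1 ≤ hi ∧ lo ⟨0, hd⟩ + 2 ≤ x ⟨0, hd⟩)
    (A : PBond P j → ℝ)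
    (hA : ∀ (x : Fin P.d → ℤ) (μ : Fin P.d), lo ≤ x → x + e μ ≤ hi → A ⟨castSite x, μ⟩ = a x μ)
    (hA0 : ∀ b : PBond P j, (¬ ∃ y : Fin P.d → ℤ, lo ≤ y ∧ y + e b.dir ≤ hi ∧ b.src = castSite y) → A b = 0)
    (p : Plaq P j) (hp : p ∉ boxPlaqs lo hi) :
    A (slotBond p 0) + A (slotBond p 1) - A (slotBond p 2) - A (slotBond p 3) = 0 := by
  by_contra hne
  exact hp (curl_support_of_margin A (push_support_margin hd a ha A hA hA0) p hne)

/-! ## §4 The torus edition of the temporal-gauge primitive -/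

/-- ★★★ **(T-PRIM) ON THE TORUS.**  For an antisymmetric, closed `ℤ^d` 2-form `r` supported with margin 1 in a NON-WRAPPING box `[lo, hi]`
(`hi κ − lo κ < sitesPerDir j`) and with zero direction-`0` column sums, there is a torus test potential `u : PBond P j → ℝ` with
(i) the SUPPORT ROW of `stub_linTest` verbatim (margin 1, off the axial comb rooted at `lo`);
(ii) on every box plaquette `⟨castSite z, μ, ν⟩` (`lo ≤ z`, `z + e_μ + e_ν ≤ hi`) the `slotBond` curl of `u` equals `r z μ ν`;
(iii) off `boxPlaqs lo hi` the `slotBond` curl of `u` vanishes;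
(iv) the column bound `|u ⟨castSite x, μ⟩| ≤ Σ_{k < hi₀ − lo₀} |r(x[0 ↦ lo₀ + k], 0, μ)|` on box bonds.
(✓`exists_temporalGauge_primitive` pushed through `castSite` by §1–§3.) [cite: Balaban1984PropagatorsI, (1.10) p.19] -/
theorem exists_torus_temporalGauge_primitive {lo hi : Fin P.d → ℤ} (hd : 0 < P.d) (hN : ∀ κ, hi κ - lo κ < P.sitesPerDir j)
    (r : Zd P.d → Fin P.d → Fin P.d → ℝ)
    (hanti : ∀ x μ ν, r x ν μ = -r x μ ν)
    (hclosed : ∀ x (κ μ ν : Fin P.d),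
      (r (x + unitVec κ) μ ν - r x μ ν) - (r (x + unitVec μ) κ ν - r x κ ν) + (r (x + unitVec ν) κ μ - r x κ μ) = 0)
    (hmargin : ∀ x μ ν, r x μ ν ≠ 0 → lo + 1 ≤ x ∧ x + unitVec μ + unitVec ν + 1 ≤ hi)
    (hcol : ∀ μ : Fin P.d, μ ≠ ⟨0, hd⟩ → ∀ y : Zd P.d,
      ∑ k ∈ Finset.range ((hi ⟨0, hd⟩ - lo ⟨0, hd⟩).toNat), r (Function.update y ⟨0, hd⟩ (lo ⟨0, hd⟩ + k)) ⟨0, hd⟩ μ = 0) :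
    ∃ u : PBond P j → ℝ,
      (∀ b, u b ≠ 0 → ∃ x : Fin P.d → ℤ, lo + 1 ≤ x ∧ x + e b.dir + 1 ≤ hi ∧ b.src = castSite x ∧ lowPart b.dir (x - lo) ≠ 0) ∧
      (∀ (z : Fin P.d → ℤ) (μ ν : Fin P.d) (hμν : μ < ν), lo ≤ z → z + e μ + e ν ≤ hi →
        u (slotBond (⟨castSite z, μ, ν, hμν⟩ : Plaq P j) 0) + u (slotBond (⟨castSite z, μ, ν, hμν⟩ : Plaq P j) 1) -
          u (slotBond (⟨castSite z, μ, ν, hμν⟩ : Plaq P j) 2) - u (slotBond (⟨castSite z, μ, ν, hμν⟩ : Plaq P j) 3) = r z μ ν) ∧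
      (∀ p : Plaq P j, p ∉ boxPlaqs lo hi → u (slotBond p 0) + u (slotBond p 1) - u (slotBond p 2) - u (slotBond p 3) = 0) ∧
      (∀ (x : Fin P.d → ℤ) (μ : Fin P.d), lo ≤ x → x + e μ ≤ hi →
        |u ⟨castSite x, μ⟩| ≤ ∑ k ∈ Finset.range ((hi ⟨0, hd⟩ - lo ⟨0, hd⟩).toNat),
          |r (Function.update x ⟨0, hd⟩ (lo ⟨0, hd⟩ + k)) ⟨0, hd⟩ μ|) := by
  obtain ⟨a, hcurl, -, hsupp, habs⟩ := exists_temporalGauge_primitive hd lo hi r hanti hclosed hmargin hcol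
  obtain ⟨A, hA, hA0⟩ := exists_push (j := j) hN a
  refine ⟨A, push_support_of_margin hd a hsupp A hA hA0, fun z μ ν hμν hz hzhi => ?_,
    curl_push_eq_zero_of_not_mem hd a hsupp A hA hA0, fun x μ hx hxμ => ?_⟩
  · rw [curl_push_of_box a A hA hμν hz hzhi]
    exact hcurl z μ ν
  · rw [hA x μ hx hxμ]
    exact habs x μ ((le_of_add_e_le μ hxμ) ⟨0, hd⟩)

/-! ## §5 Reindexing torus sums over a non-wrapping box (the energy ∕ mass rows of `stub_linTest` in `ℤ^d` letters) -/

/-- ★ **BOND SUMS**: a torus bond field vanishing off the box-bond image sums, over ALL of `PBond P j`, to its `ℤ^d` read-out over the integer box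
`Π_i [lo_i, hi_i]` (extra pairs `(x, μ)` with `x + e_μ` outside the box contribute `0` by injectivity of `castSite` on the box). [folklore] -/
theorem sum_pbond_eq_sum_box {M : Type*} [AddCommMonoid M] {lo hi : Fin P.d → ℤ} (hN : ∀ κ, hi κ - lo κ < P.sitesPerDir j)
    (F : PBond P j → M) (hF : ∀ b, F b ≠ 0 → ∃ x : Fin P.d → ℤ, lo ≤ x ∧ x + e b.dir ≤ hi ∧ b.src = castSite x) :
    ∑ b : PBond P j, F b = ∑ x ∈ Fintype.piFinset (fun i => Finset.Icc (lo i) (hi i)), ∑ μ : Fin P.d, F ⟨castSite x, μ⟩ := by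
  classical
  have mem_box : ∀ x : Fin P.d → ℤ, x ∈ Fintype.piFinset (fun i => Finset.Icc (lo i) (hi i)) ↔ lo ≤ x ∧ x ≤ hi := by
    intro x
    simp only [Fintype.mem_piFinset, Finset.mem_Icc]
    exact ⟨fun h => ⟨fun i => (h i).1, fun i => (h i).2⟩, fun h i => ⟨h.1 i, h.2 i⟩⟩
  set B := Fintype.piFinset (fun i => Finset.Icc (lo i) (hi i)) with hB
  let mk : (Fin P.d → ℤ) × Fin P.d → PBond P j := fun q => ⟨castSite q.1, q.2⟩
  have hinj : ∀ q ∈ B ×ˢ (Finset.univ : Finset (Fin P.d)), ∀ q' ∈ B ×ˢ (Finset.univ : Finset (Fin P.d)), mk q = mk q' → q = q' := by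
    intro q hq q' hq' h
    have h1 : (castSite q.1 : Site P j) = castSite q'.1 := congrArg PBond.src h
    have h2 : q.2 = q'.2 := congrArg PBond.dir h
    have hq1 := (mem_box q.1).1 (Finset.mem_product.1 hq).1
    have hq1' := (mem_box q'.1).1 (Finset.mem_product.1 hq').1
    exact Prod.ext (castSite_injOn_box hN hq1.1 hq1.2 hq1'.1 hq1'.2 h1) h2
  rw [show (∑ x ∈ B, ∑ μ : Fin P.d, F ⟨castSite x, μ⟩) = ∑ q ∈ B ×ˢ (Finset.univ : Finset (Fin P.d)), F (mk q) from
    (Finset.sum_product B Finset.univ (fun q => F (mk q))).symm, ← Finset.sum_image hinj]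
  refine (Finset.sum_subset (Finset.subset_univ _) fun b _ hb => ?_).symm
  by_contra hne
  obtain ⟨x, hx, hxμ, hsrc⟩ := hF b hne
  apply hb
  refine Finset.mem_image.2 ⟨(x, b.dir), Finset.mem_product.2 ⟨(mem_box x).2 ⟨hx, le_of_add_e_le b.dir hxμ⟩, Finset.mem_univ _⟩, ?_⟩
  cases b
  simp only at hsrc
  simp only [mk, hsrc]

/-- ★ **PLAQUETTE SUMS**: a torus plaquette function vanishing off `boxPlaqs lo hi` sums, over ALL of `Plaq P j`, to its `ℤ^d` read-out over the integer box
and the ordered direction pairs. [folklore] -/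
theorem sum_plaq_eq_sum_box {M : Type*} [AddCommMonoid M] {lo hi : Fin P.d → ℤ} (hN : ∀ κ, hi κ - lo κ < P.sitesPerDir j)
    (G : Plaq P j → M) (hG : ∀ p, G p ≠ 0 → p ∈ boxPlaqs lo hi) :
    ∑ p : Plaq P j, G p =
      ∑ z ∈ Fintype.piFinset (fun i => Finset.Icc (lo i) (hi i)), ∑ q : {q : Fin P.d × Fin P.d // q.1 < q.2},
        G ⟨castSite z, q.1.1, q.1.2, q.2⟩ := by
  classical
  have mem_box : ∀ x : Fin P.d → ℤ, x ∈ Fintype.piFinset (fun i => Finset.Icc (lo i) (hi i)) ↔ lo ≤ x ∧ x ≤ hi := by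
    intro x
    simp only [Fintype.mem_piFinset, Finset.mem_Icc]
    exact ⟨fun h => ⟨fun i => (h i).1, fun i => (h i).2⟩, fun h i => ⟨h.1 i, h.2 i⟩⟩
  set B := Fintype.piFinset (fun i => Finset.Icc (lo i) (hi i)) with hB
  let mk : (Fin P.d → ℤ) × {q : Fin P.d × Fin P.d // q.1 < q.2} → Plaq P j := fun t => ⟨castSite t.1, t.2.1.1, t.2.1.2, t.2.2⟩
  have hinj : ∀ t ∈ B ×ˢ (Finset.univ : Finset {q : Fin P.d × Fin P.d // q.1 < q.2}),
      ∀ t' ∈ B ×ˢ (Finset.univ : Finset {q : Fin P.d × Fin P.d // q.1 < q.2}), mk t = mk t' → t = t' := by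
    intro t ht t' ht' h
    have h1 : (castSite t.1 : Site P j) = castSite t'.1 := congrArg Plaq.src h
    have h2 : t.2.1.1 = t'.2.1.1 := congrArg Plaq.μ h
    have h3 : t.2.1.2 = t'.2.1.2 := congrArg Plaq.ν h
    have ht1 := (mem_box t.1).1 (Finset.mem_product.1 ht).1
    have ht1' := (mem_box t'.1).1 (Finset.mem_product.1 ht').1
    refine Prod.ext (castSite_injOn_box hN ht1.1 ht1.2 ht1'.1 ht1'.2 h1) (Subtype.ext (Prod.ext h2 h3))
  rw [show (∑ z ∈ B, ∑ q : {q : Fin P.d × Fin P.d // q.1 < q.2}, G ⟨castSite z, q.1.1, q.1.2, q.2⟩) =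
      ∑ t ∈ B ×ˢ (Finset.univ : Finset {q : Fin P.d × Fin P.d // q.1 < q.2}), G (mk t) from
    (Finset.sum_product B Finset.univ (fun t => G (mk t))).symm, ← Finset.sum_image hinj]
  refine (Finset.sum_subset (Finset.subset_univ _) fun p _ hp => ?_).symm
  by_contra hne
  obtain ⟨z, hz, hzhi, hsrc⟩ := hG p hne
  apply hp
  have hzhi' : z ≤ hi := le_of_add_e_le p.μ (le_of_add_e_le p.ν hzhi)
  refine Finset.mem_image.2 ⟨(z, ⟨(p.μ, p.ν), p.hμν⟩), Finset.mem_product.2 ⟨(mem_box z).2 ⟨hz, hzhi'⟩, Finset.mem_univ _⟩, ?_⟩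
  cases p
  simp only at hsrc
  simp only [mk, hsrc]

/-! ## §6 The torus primitive with its energy and mass rows read on `ℤ^d` -/

/-- ★★★ **(T-PRIM) ON THE TORUS, WITH THE SUM ROWS**: as `exists_torus_temporalGauge_primitive`, plus (v) the PINNED CURL ENERGY read on `ℤ^d`:
`Σ_{p : Plaq} (du)_p² = Σ_{z ∈ box} Σ_{μ<ν} r(z,μ,ν)²`, and (vi) the MASS ROW in column form: `Σ_{b : PBond} (u b)² ≤ Σ_{x ∈ box} Σ_μ (Σ_k |r(x[0↦lo₀+k],0,μ)|)²`.
[cite: Balaban1984PropagatorsI, (1.10) p.19] -/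
theorem exists_torus_temporalGauge_primitive_sums {lo hi : Fin P.d → ℤ} (hd : 0 < P.d) (hN : ∀ κ, hi κ - lo κ < P.sitesPerDir j)
    (r : Zd P.d → Fin P.d → Fin P.d → ℝ)
    (hanti : ∀ x μ ν, r x ν μ = -r x μ ν)
    (hclosed : ∀ x (κ μ ν : Fin P.d),
      (r (x + unitVec κ) μ ν - r x μ ν) - (r (x + unitVec μ) κ ν - r x κ ν) + (r (x + unitVec ν) κ μ - r x κ μ) = 0)
    (hmargin : ∀ x μ ν, r x μ ν ≠ 0 → lo + 1 ≤ x ∧ x + unitVec μ + unitVec ν + 1 ≤ hi)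
    (hcol : ∀ μ : Fin P.d, μ ≠ ⟨0, hd⟩ → ∀ y : Zd P.d,
      ∑ k ∈ Finset.range ((hi ⟨0, hd⟩ - lo ⟨0, hd⟩).toNat), r (Function.update y ⟨0, hd⟩ (lo ⟨0, hd⟩ + k)) ⟨0, hd⟩ μ = 0) :
    ∃ u : PBond P j → ℝ,
      (∀ b, u b ≠ 0 → ∃ x : Fin P.d → ℤ, lo + 1 ≤ x ∧ x + e b.dir + 1 ≤ hi ∧ b.src = castSite x ∧ lowPart b.dir (x - lo) ≠ 0) ∧
      (∀ (z : Fin P.d → ℤ) (μ ν : Fin P.d) (hμν : μ < ν), lo ≤ z → z + e μ + e ν ≤ hi →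
        u (slotBond (⟨castSite z, μ, ν, hμν⟩ : Plaq P j) 0) + u (slotBond (⟨castSite z, μ, ν, hμν⟩ : Plaq P j) 1) -
          u (slotBond (⟨castSite z, μ, ν, hμν⟩ : Plaq P j) 2) - u (slotBond (⟨castSite z, μ, ν, hμν⟩ : Plaq P j) 3) = r z μ ν) ∧
      (∀ p : Plaq P j, p ∉ boxPlaqs lo hi → u (slotBond p 0) + u (slotBond p 1) - u (slotBond p 2) - u (slotBond p 3) = 0) ∧
      (∀ (x : Fin P.d → ℤ) (μ : Fin P.d), lo ≤ x → x + e μ ≤ hi →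
        |u ⟨castSite x, μ⟩| ≤ ∑ k ∈ Finset.range ((hi ⟨0, hd⟩ - lo ⟨0, hd⟩).toNat),
          |r (Function.update x ⟨0, hd⟩ (lo ⟨0, hd⟩ + k)) ⟨0, hd⟩ μ|) ∧
      ∑ p : Plaq P j, (u (slotBond p 0) + u (slotBond p 1) - u (slotBond p 2) - u (slotBond p 3)) ^ 2 =
        ∑ z ∈ Fintype.piFinset (fun i => Finset.Icc (lo i) (hi i)), ∑ q : {q : Fin P.d × Fin P.d // q.1 < q.2},
          r z q.1.1 q.1.2 ^ 2 ∧
      ∑ b : PBond P j, u b ^ 2 ≤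
        ∑ x ∈ Fintype.piFinset (fun i => Finset.Icc (lo i) (hi i)), ∑ μ : Fin P.d,
          (∑ k ∈ Finset.range ((hi ⟨0, hd⟩ - lo ⟨0, hd⟩).toNat), |r (Function.update x ⟨0, hd⟩ (lo ⟨0, hd⟩ + k)) ⟨0, hd⟩ μ|) ^ 2 := by
  classical
  obtain ⟨a, hcurl, -, hsupp, habs⟩ := exists_temporalGauge_primitive hd lo hi r hanti hclosed hmargin hcol
  obtain ⟨A, hA, hA0⟩ := exists_push (j := j) hN a
  have hrow := push_support_of_margin hd a hsupp A hA hA0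
  have hbox : ∀ (z : Fin P.d → ℤ) (μ ν : Fin P.d) (hμν : μ < ν), lo ≤ z → z + e μ + e ν ≤ hi →
      A (slotBond (⟨castSite z, μ, ν, hμν⟩ : Plaq P j) 0) + A (slotBond (⟨castSite z, μ, ν, hμν⟩ : Plaq P j) 1) -
        A (slotBond (⟨castSite z, μ, ν, hμν⟩ : Plaq P j) 2) - A (slotBond (⟨castSite z, μ, ν, hμν⟩ : Plaq P j) 3) = r z μ ν := by
    intro z μ ν hμν hz hzhi
    rw [curl_push_of_box a A hA hμν hz hzhi]
    exact hcurl z μ ν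
  have hoff := curl_push_eq_zero_of_not_mem hd a hsupp A hA hA0
  have mem_box : ∀ x : Fin P.d → ℤ, x ∈ Fintype.piFinset (fun i => Finset.Icc (lo i) (hi i)) ↔ lo ≤ x ∧ x ≤ hi := by
    intro x
    simp only [Fintype.mem_piFinset, Finset.mem_Icc]
    exact ⟨fun h => ⟨fun i => (h i).1, fun i => (h i).2⟩, fun h i => ⟨h.1 i, h.2 i⟩⟩
  refine ⟨A, hrow, hbox, hoff, fun x μ hx hxμ => ?_, ?_, ?_⟩
  · rw [hA x μ hx hxμ]
    exact habs x μ ((le_of_add_e_le μ hxμ) ⟨0, hd⟩)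
  · -- (v) the energy identity
    rw [sum_plaq_eq_sum_box hN (fun p : Plaq P j => (A (slotBond p 0) + A (slotBond p 1) - A (slotBond p 2) - A (slotBond p 3)) ^ 2)
      (fun p hp => by
        by_contra hnot
        exact hp (by rw [hoff p hnot]; ring))]
    refine Finset.sum_congr rfl fun z hz => Finset.sum_congr rfl fun q _ => ?_
    obtain ⟨hzlo, hzhi⟩ := (mem_box z).1 hz
    by_cases hin : z + e q.1.1 + e q.1.2 ≤ hi
    · rw [hbox z q.1.1 q.1.2 q.2 hzlo hin]
    · -- the plaquette sticks out of the box: both sides vanish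
      have hl : A (slotBond (⟨castSite z, q.1.1, q.1.2, q.2⟩ : Plaq P j) 0) + A (slotBond (⟨castSite z, q.1.1, q.1.2, q.2⟩ : Plaq P j) 1) -
          A (slotBond (⟨castSite z, q.1.1, q.1.2, q.2⟩ : Plaq P j) 2) - A (slotBond (⟨castSite z, q.1.1, q.1.2, q.2⟩ : Plaq P j) 3) = 0 := by
        refine hoff _ fun hmem => hin ?_
        obtain ⟨z', hz', hz'hi, hsrc⟩ := hmem
        simp only at hsrc hz'hi
        have hz'le : z' ≤ hi := le_of_add_e_le q.1.1 (le_of_add_e_le q.1.2 hz'hi)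
        rw [castSite_injOn_box hN hzlo hzhi hz' hz'le hsrc]
        exact hz'hi
      have hr : r z q.1.1 q.1.2 = 0 := by
        by_contra hne
        have h2 := (hmargin z q.1.1 q.1.2 hne).2
        apply hin
        intro κ
        have := h2 κ
        simp only [Pi.add_apply, Pi.one_apply, e_eq_unitVec] at this ⊢
        omega
      rw [hl, hr]
  · -- (vi) the mass row in column form
    rw [sum_pbond_eq_sum_box hN (fun b : PBond P j => A b ^ 2)
      (fun b hb => by
        by_cases h : ∃ y : Fin P.d → ℤ, lo ≤ y ∧ y + e b.dir ≤ hi ∧ b.src = castSite y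
        · exact h
        · exact absurd (by rw [hA0 b h]; ring) hb)]
    · refine Finset.sum_le_sum fun x hx => Finset.sum_le_sum fun μ _ => ?_
      obtain ⟨hxlo, hxhi⟩ := (mem_box x).1 hx
      by_cases hin : x + e μ ≤ hi
      · rw [hA x μ hxlo hin]
        have hb := habs x μ (hxhi ⟨0, hd⟩)
        have h0 : 0 ≤ |a x μ| := abs_nonneg _
        calc a x μ ^ 2 = |a x μ| ^ 2 := (sq_abs _).symm
          _ ≤ _ := pow_le_pow_left₀ h0 hb 2
      · have h0 : A ⟨castSite x, μ⟩ = 0 := by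
          refine hA0 _ fun ⟨y, hy, hyμ, hsrc⟩ => hin ?_
          simp only at hsrc hyμ
          rw [castSite_injOn_box hN hxlo hxhi hy (le_of_add_e_le μ hyμ) hsrc]
          exact hyμ
        rw [h0]
        simp only [ne_eq, OfNat.ofNat_ne_zero, not_false_eq_true, zero_pow]
        positivity

end Summit.QuantumFields.YangMills.Theorems.UnitScaleGibbsTemporalGaugePrimitiveTorus

end
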